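import Literature.MathematicalPhysics.QuantumFieldTheory.ConformalBootstrap3D.PointFunctionalTail

/-!
# Termwise rules for point functionals: monotone corner bounds and the split tail

Continuation of `PointFunctionalTail`. A point-functional certificate (architecture B″) discharges
the positivity of `Φ(E,j,s) := φ[F^{s}_{-}[𝒫_{E,j}]]` — the value of the functional on ONE term of the
`z`-series of a block (`IsConformalBlock3D.hasSum_hrZTerm`) — for whole RANGES of the real
parameters `E` (`= Δ + n`) and `s` (`= Δ_σ` in a box):

* **(M) monotone corner bound** (`termCornerBound_le`, `termwise_nonneg_of_cornerBound`): every
  evaluation `𝒫_{E,j}(x,y) = (xy)^{(E-j)/2} 𝒫_j(x,y)` is non-increasing in `E` (`0 < x, y < 1`) and the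
  weights `v^s = ((1-z)(1-z̄))^s`, `u^s = (z z̄)^s` are non-increasing in `s`, so on a box
  `E ∈ [E₁, E₂]`, `s ∈ [s_lo, s_hi]` the value `Φ(E,j,s)` is bounded below by the explicit corner
  expression `termCornerBound` (positive parts of the weights at the far corner, negative parts at
  the near corner). One inequality per box. [folklore]
* **(T) per term** (`term_nonneg_of_apex`): with a dominating apex (see `PointFunctionalTail`), the
  single inequality `B(s; E_T) ≥ 0` makes EVERY term with `E ≥ E_T`, `j ≤ E` non-negative. [folklore]
* **the split tail** (`tail_nonneg_pointFunctional_of_termwise_and_apex`): obligation (O5) of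
  `SingleCorrelatorObligations` with threshold `Δ⋆ = E₀` follows from (M)-type termwise positivity
  for `E ∈ [E₀, E_T)` (an abstract hypothesis, to be covered by finitely many corner boxes) and the
  (T) inequality at `E_T` — the shape `E₀ = 24`, `E_T = 60` of the engineers' point certificates.
  Non-regular `(Δ, ℓ)` are reached through the limit clause
  (`eventually_isRegularPoint3D_nhdsGT_of_bound_le`). [folklore]

Source of the term basis: Hogervorst–Rychkov 2013, §3 eq. (3.6). [cite: HogervorstRychkov2013, §3 eq. (3.6)]
No block is evaluated here.
-/

noncomputable section

namespace Literature.MathematicalPhysics.QuantumFieldTheory.ConformalBootstrap3D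

open Finset Set Filter Topology

/-! ### Elementary monotone splitting -/

/-- `w f ≥ w⁺ f_lo - w⁻ f_hi` for `f_lo ≤ f ≤ f_hi`. [folklore] -/
theorem max_mul_sub_max_mul_le {w f fl fu : ℝ} (h1 : fl ≤ f) (h2 : f ≤ fu) :
    max w 0 * fl - max (-w) 0 * fu ≤ w * f := by
  rcases le_total 0 w with hw | hw
  · calc max w 0 * fl - max (-w) 0 * fu = w * fl := by
          rw [max_eq_left hw, max_eq_right (neg_nonpos.2 hw)]; ring
      _ ≤ w * f := mul_le_mul_of_nonneg_left h1 hw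
  · calc max w 0 * fl - max (-w) 0 * fu = w * fu := by
          rw [max_eq_right hw, max_eq_left (neg_nonneg.2 hw)]; ring
      _ ≤ w * f := mul_le_mul_of_nonpos_left h2 hw

/-- `-(w f) ≥ w⁻ f_lo - w⁺ f_hi` for `f_lo ≤ f ≤ f_hi`. [folklore] -/
theorem max_neg_mul_sub_max_mul_le {w f fl fu : ℝ} (h1 : fl ≤ f) (h2 : f ≤ fu) :
    max (-w) 0 * fl - max w 0 * fu ≤ -(w * f) := by
  calc max (-w) 0 * fl - max w 0 * fu = max (-w) 0 * fl - max (-(-w)) 0 * fu := by rw [neg_neg]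
    _ ≤ -w * f := max_mul_sub_max_mul_le h1 h2
    _ = -(w * f) := by ring

/-- `𝒫_{E,j}(x,y)` is non-increasing in `E` at a point of the open square. [folklore] -/
theorem zMono_le_zMono_of_le {x y : ℝ} (hx : 0 < x) (hx1 : x < 1) (hy : 0 < y) (hy1 : y < 1) (j : ℕ)
    {E₁ E₂ : ℝ} (h : E₁ ≤ E₂) : zMono E₂ j x y ≤ zMono E₁ j x y := by
  unfold zMono
  have hxy : 0 < x * y := mul_pos hx hy
  have hxy1 : x * y ≤ 1 := by nlinarith
  exact mul_le_mul_of_nonneg_right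
    (Real.rpow_le_rpow_of_exponent_ge hxy hxy1 (by linarith : (E₁ - (j : ℝ)) / 2 ≤ (E₂ - (j : ℝ)) / 2))
    (zLegendre_nonneg j hx.le hy.le)

/-! ### (M): the corner bound on a box `E ∈ [E₁, E₂]`, `s ∈ [s_lo, s_hi]` -/

/-- **Corner bound** for `Φ(E,j,s) = Σ_k w_k (v_k^s 𝒫_{E,j}(z_k,z̄_k) - u_k^s 𝒫_{E,j}(1-z_k,1-z̄_k))` on the
box `E ∈ [E₁, E₂]`, `s ∈ [s_lo, s_hi]`: positive parts of the weights evaluated at the far corner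
`(E₂, s_hi)`, negative parts at the near corner `(E₁, s_lo)`. [folklore] -/
def termCornerBound {N : ℕ} (w z zb : Fin N → ℝ) (j : ℕ) (E₁ E₂ slo shi : ℝ) : ℝ :=
  ∑ k, ((max (w k) 0 * (((1 - z k) * (1 - zb k)) ^ shi * zMono E₂ j (z k) (zb k))
        - max (-(w k)) 0 * (((1 - z k) * (1 - zb k)) ^ slo * zMono E₁ j (z k) (zb k)))
      + (max (-(w k)) 0 * ((z k * zb k) ^ shi * zMono E₂ j (1 - z k) (1 - zb k))
        - max (w k) 0 * ((z k * zb k) ^ slo * zMono E₁ j (1 - z k) (1 - zb k))))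

/-- **(M) The corner bound is a lower bound on the whole box.** [folklore] -/
theorem termCornerBound_le {N : ℕ} (w z zb : Fin N → ℝ)
    (hz : ∀ k, z k ∈ Ioo (0 : ℝ) 1) (hzb : ∀ k, zb k ∈ Ioo (0 : ℝ) 1) (j : ℕ)
    {E₁ E₂ slo shi E s : ℝ} (hE : E ∈ Icc E₁ E₂) (hs : s ∈ Icc slo shi) :
    termCornerBound w z zb j E₁ E₂ slo shi ≤ pointFunctional w z zb (crossF s (-1) (zMono E j)) := by
  rw [pointFunctional_apply]
  unfold termCornerBound
  refine sum_le_sum fun k _ => ?_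
  have hz0 := (hz k).1; have hz1 := (hz k).2; have hzb0 := (hzb k).1; have hzb1 := (hzb k).2
  have hv : 0 < (1 - z k) * (1 - zb k) ∧ (1 - z k) * (1 - zb k) ≤ 1 :=
    ⟨mul_pos (by linarith) (by linarith), mul_le_one₀ (by linarith) (by linarith) (by linarith)⟩
  have hu : 0 < z k * zb k ∧ z k * zb k ≤ 1 := ⟨mul_pos hz0 hzb0, mul_le_one₀ hz1.le hzb0.le hzb1.le⟩
  have hM1 : zMono E j (z k) (zb k) ≤ zMono E₁ j (z k) (zb k) :=
    zMono_le_zMono_of_le hz0 hz1 hzb0 hzb1 j hE.1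
  have hM2 : zMono E₂ j (z k) (zb k) ≤ zMono E j (z k) (zb k) :=
    zMono_le_zMono_of_le hz0 hz1 hzb0 hzb1 j hE.2
  have hR1 : zMono E j (1 - z k) (1 - zb k) ≤ zMono E₁ j (1 - z k) (1 - zb k) :=
    zMono_le_zMono_of_le (by linarith) (by linarith) (by linarith) (by linarith) j hE.1
  have hR2 : zMono E₂ j (1 - z k) (1 - zb k) ≤ zMono E j (1 - z k) (1 - zb k) :=
    zMono_le_zMono_of_le (by linarith) (by linarith) (by linarith) (by linarith) j hE.2
  have hv1 : ((1 - z k) * (1 - zb k)) ^ s ≤ ((1 - z k) * (1 - zb k)) ^ slo :=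
    Real.rpow_le_rpow_of_exponent_ge hv.1 hv.2 hs.1
  have hv2 : ((1 - z k) * (1 - zb k)) ^ shi ≤ ((1 - z k) * (1 - zb k)) ^ s :=
    Real.rpow_le_rpow_of_exponent_ge hv.1 hv.2 hs.2
  have hu1 : (z k * zb k) ^ s ≤ (z k * zb k) ^ slo := Real.rpow_le_rpow_of_exponent_ge hu.1 hu.2 hs.1
  have hu2 : (z k * zb k) ^ shi ≤ (z k * zb k) ^ s := Real.rpow_le_rpow_of_exponent_ge hu.1 hu.2 hs.2
  have hMn : ∀ E', 0 ≤ zMono E' j (z k) (zb k) := fun E' => zMono_nonneg E' j hz0.le hzb0.le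
  have hRn : ∀ E', 0 ≤ zMono E' j (1 - z k) (1 - zb k) := fun E' =>
    zMono_nonneg E' j (by linarith) (by linarith)
  have h1 : ((1 - z k) * (1 - zb k)) ^ shi * zMono E₂ j (z k) (zb k) ≤
      ((1 - z k) * (1 - zb k)) ^ s * zMono E j (z k) (zb k) :=
    mul_le_mul hv2 hM2 (hMn _) (Real.rpow_nonneg hv.1.le _)
  have h2 : ((1 - z k) * (1 - zb k)) ^ s * zMono E j (z k) (zb k) ≤
      ((1 - z k) * (1 - zb k)) ^ slo * zMono E₁ j (z k) (zb k) :=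
    mul_le_mul hv1 hM1 (hMn _) (Real.rpow_nonneg hv.1.le _)
  have h3 : (z k * zb k) ^ shi * zMono E₂ j (1 - z k) (1 - zb k) ≤
      (z k * zb k) ^ s * zMono E j (1 - z k) (1 - zb k) :=
    mul_le_mul hu2 hR2 (hRn _) (Real.rpow_nonneg hu.1.le _)
  have h4 : (z k * zb k) ^ s * zMono E j (1 - z k) (1 - zb k) ≤
      (z k * zb k) ^ slo * zMono E₁ j (1 - z k) (1 - zb k) :=
    mul_le_mul hu1 hR1 (hRn _) (Real.rpow_nonneg hu.1.le _)
  have i1 := max_mul_sub_max_mul_le (w := w k) h1 h2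
  have i2 := max_neg_mul_sub_max_mul_le (w := w k) h3 h4
  calc (max (w k) 0 * (((1 - z k) * (1 - zb k)) ^ shi * zMono E₂ j (z k) (zb k))
        - max (-(w k)) 0 * (((1 - z k) * (1 - zb k)) ^ slo * zMono E₁ j (z k) (zb k)))
      + (max (-(w k)) 0 * ((z k * zb k) ^ shi * zMono E₂ j (1 - z k) (1 - zb k))
        - max (w k) 0 * ((z k * zb k) ^ slo * zMono E₁ j (1 - z k) (1 - zb k)))
      ≤ w k * (((1 - z k) * (1 - zb k)) ^ s * zMono E j (z k) (zb k))
        + -(w k * ((z k * zb k) ^ s * zMono E j (1 - z k) (1 - zb k))) := add_le_add i1 i2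
    _ = w k * crossF s (-1) (zMono E j) (z k) (zb k) := by
        simp only [crossF]
        ring

/-- **(M) as used by a certificate:** one inequality `0 ≤ termCornerBound` per box gives
`Φ(E,j,s) ≥ 0` on the whole box `E ∈ [E₁, E₂]`, `s ∈ [s_lo, s_hi]`. [folklore] -/
theorem termwise_nonneg_of_cornerBound {N : ℕ} (w z zb : Fin N → ℝ)
    (hz : ∀ k, z k ∈ Ioo (0 : ℝ) 1) (hzb : ∀ k, zb k ∈ Ioo (0 : ℝ) 1) (j : ℕ)
    {E₁ E₂ slo shi : ℝ} (h : 0 ≤ termCornerBound w z zb j E₁ E₂ slo shi) :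
    ∀ E ∈ Icc E₁ E₂, ∀ s ∈ Icc slo shi, 0 ≤ pointFunctional w z zb (crossF s (-1) (zMono E j)) :=
  fun _ hE _ hs => h.trans (termCornerBound_le w z zb hz hzb j hE hs)

/-! ### (T) per term, and the box form of the apex inequality -/

/-- The apex inequality on a box of external dimensions: `v^s`, `u^s` are non-increasing in `s`, so
the inequality with `v_a^{s_hi}` on the right and `v_k^{s_lo}`, `u_k^{s_lo}` on the left implies it
for every `s ∈ [s_lo, s_hi]` (`0 ≤ w_a`). [folklore] -/
theorem apexIneq_of_box {N : ℕ} (w z zb : Fin N → ℝ)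
    (hz : ∀ k, z k ∈ Ioo (0 : ℝ) 1) (hzb : ∀ k, zb k ∈ Ioo (0 : ℝ) 1) (a : Fin N) (ha : 0 ≤ w a)
    (qd qr : Fin N → ℝ) (hqd : ∀ k, 0 ≤ qd k) (hqr : ∀ k, 0 ≤ qr k) {slo shi s T : ℝ}
    (hs : slo ≤ s ∧ s ≤ shi)
    (hB : ∑ k ∈ univ.erase a, |w k| * ((1 - z k) * (1 - zb k)) ^ slo * qd k ^ T
          + ∑ k, |w k| * (z k * zb k) ^ slo * qr k ^ T ≤ w a * ((1 - z a) * (1 - zb a)) ^ shi) :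
    ∑ k ∈ univ.erase a, |w k| * ((1 - z k) * (1 - zb k)) ^ s * qd k ^ T
        + ∑ k, |w k| * (z k * zb k) ^ s * qr k ^ T ≤ w a * ((1 - z a) * (1 - zb a)) ^ s := by
  have hv : ∀ k, 0 < (1 - z k) * (1 - zb k) ∧ (1 - z k) * (1 - zb k) ≤ 1 := fun k =>
    ⟨mul_pos (by linarith [(hz k).2]) (by linarith [(hzb k).2]),
      mul_le_one₀ (by linarith [(hz k).1]) (by linarith [(hzb k).2]) (by linarith [(hzb k).1])⟩
  have hu : ∀ k, 0 < z k * zb k ∧ z k * zb k ≤ 1 := fun k =>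
    ⟨mul_pos (hz k).1 (hzb k).1, mul_le_one₀ (hz k).2.le (hzb k).1.le (hzb k).2.le⟩
  have h1 : ∑ k ∈ univ.erase a, |w k| * ((1 - z k) * (1 - zb k)) ^ s * qd k ^ T ≤
      ∑ k ∈ univ.erase a, |w k| * ((1 - z k) * (1 - zb k)) ^ slo * qd k ^ T :=
    sum_le_sum fun k _ => mul_le_mul_of_nonneg_right
      (mul_le_mul_of_nonneg_left
        (Real.rpow_le_rpow_of_exponent_ge (hv k).1 (hv k).2 hs.1) (abs_nonneg _))
      (Real.rpow_nonneg (hqd k) _)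
  have h2 : ∑ k, |w k| * (z k * zb k) ^ s * qr k ^ T ≤ ∑ k, |w k| * (z k * zb k) ^ slo * qr k ^ T :=
    sum_le_sum fun k _ => mul_le_mul_of_nonneg_right
      (mul_le_mul_of_nonneg_left
        (Real.rpow_le_rpow_of_exponent_ge (hu k).1 (hu k).2 hs.1) (abs_nonneg _))
      (Real.rpow_nonneg (hqr k) _)
  have h3 : w a * ((1 - z a) * (1 - zb a)) ^ shi ≤ w a * ((1 - z a) * (1 - zb a)) ^ s :=
    mul_le_mul_of_nonneg_left (Real.rpow_le_rpow_of_exponent_ge (hv a).1 (hv a).2 hs.2) ha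
  linarith

/-- **(T) per term.** In the dominated configuration (apex `a`, ratios `qd_k, qr_k ∈ (0, 1]`), the
inequality `Σ_{k≠a} |w_k| v_k^s qd_k^{E_T} + Σ_k |w_k| u_k^s qr_k^{E_T} ≤ w_a v_a^s` gives
`Φ(E,j,s) ≥ 0` for every real `E ≥ E_T` and every `j ≤ E`. [folklore] -/
theorem term_nonneg_of_apex {N : ℕ} (w z zb : Fin N → ℝ)
    (hz : ∀ k, z k ∈ Ioo (0 : ℝ) 1) (hzb : ∀ k, zb k ∈ Ioo (0 : ℝ) 1) (hord : ∀ k, zb k ≤ z k)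
    (a : Fin N) (qd qr : Fin N → ℝ) (hqd : ∀ k, 0 < qd k ∧ qd k ≤ 1)
    (hqr : ∀ k, 0 < qr k ∧ qr k ≤ 1)
    (hdomd : ∀ k, z k * zb k ≤ qd k ^ 2 * (z a * zb a) ∧ z k ≤ qd k * z a)
    (hdomr : ∀ k, (1 - z k) * (1 - zb k) ≤ qr k ^ 2 * (z a * zb a) ∧ 1 - zb k ≤ qr k * z a)
    {ET s E : ℝ} {j : ℕ}
    (hB : ∑ k ∈ univ.erase a, |w k| * ((1 - z k) * (1 - zb k)) ^ s * qd k ^ ET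
          + ∑ k, |w k| * (z k * zb k) ^ s * qr k ^ ET ≤ w a * ((1 - z a) * (1 - zb a)) ^ s)
    (hjE : (j : ℝ) ≤ E) (hTE : ET ≤ E) :
    0 ≤ pointFunctional w z zb (crossF s (-1) (zMono E j)) := by
  have hlow := pointFunctional_crossF_zMono_lower w z zb hz hzb hord a qd qr (fun k => (hqd k).1)
    (fun k => (hqr k).1) hdomd hdomr hjE s
  refine le_trans (mul_nonneg (zMono_nonneg _ _ (hz a).1.le (hzb a).1.le) ?_) hlow
  have hv0 : ∀ k, 0 ≤ (1 - z k) * (1 - zb k) := fun k =>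
    mul_nonneg (by linarith [(hz k).2]) (by linarith [(hzb k).2])
  have hu0 : ∀ k, 0 ≤ z k * zb k := fun k => mul_nonneg (hz k).1.le (hzb k).1.le
  have hS1 : ∑ k ∈ univ.erase a, |w k| * ((1 - z k) * (1 - zb k)) ^ s * qd k ^ E ≤
      ∑ k ∈ univ.erase a, |w k| * ((1 - z k) * (1 - zb k)) ^ s * qd k ^ ET :=
    sum_le_sum fun k _ => mul_le_mul_of_nonneg_left
      (Real.rpow_le_rpow_of_exponent_ge (hqd k).1 (hqd k).2 hTE)
      (mul_nonneg (abs_nonneg _) (Real.rpow_nonneg (hv0 k) s))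
  have hS2 : ∑ k, |w k| * (z k * zb k) ^ s * qr k ^ E ≤ ∑ k, |w k| * (z k * zb k) ^ s * qr k ^ ET :=
    sum_le_sum fun k _ => mul_le_mul_of_nonneg_left
      (Real.rpow_le_rpow_of_exponent_ge (hqr k).1 (hqr k).2 hTE)
      (mul_nonneg (abs_nonneg _) (Real.rpow_nonneg (hu0 k) s))
  linarith

/-! ### The split tail: (M) on `[E₀, E_T)`, (T) on `[E_T, ∞)` -/

/-- `ℓ + 1/2 ≤ unitarityBound3D ℓ` (`= 1/2` for `ℓ = 0`, `ℓ + 1` otherwise): every `z`-series term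
`(n, j)` of a block above the bound has `j + 1/2 ≤ ℓ + n + 1/2 ≤ Δ + n = E`. [folklore] -/
theorem natCast_add_half_le_unitarityBound3D (ℓ : ℕ) : (ℓ : ℝ) + 1 / 2 ≤ unitarityBound3D ℓ := by
  unfold unitarityBound3D
  split_ifs with h
  · simp [h]
  · linarith

/-- **Split tail at a regular point.** Termwise positivity of `Φ(E, j, s)` for
`E ∈ [E₀, E_T)`, `j + 1/2 ≤ E` (hypothesis `hM`, rule (M)) together with the apex inequality at
`E_T` (rule (T)) gives `BlockPositive φ s Δ ℓ` for every spin and every regular `Δ ≥ E₀` above the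
unitarity bound. [folklore] -/
theorem tail_blockPositive_of_termwise_and_apex {N : ℕ} (w z zb : Fin N → ℝ)
    (hz : ∀ k, z k ∈ Ioo (0 : ℝ) 1) (hzb : ∀ k, zb k ∈ Ioo (0 : ℝ) 1) (hord : ∀ k, zb k ≤ z k)
    (a : Fin N) (qd qr : Fin N → ℝ) (hqd : ∀ k, 0 < qd k ∧ qd k ≤ 1)
    (hqr : ∀ k, 0 < qr k ∧ qr k ≤ 1)
    (hdomd : ∀ k, z k * zb k ≤ qd k ^ 2 * (z a * zb a) ∧ z k ≤ qd k * z a)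
    (hdomr : ∀ k, (1 - z k) * (1 - zb k) ≤ qr k ^ 2 * (z a * zb a) ∧ 1 - zb k ≤ qr k * z a)
    {s E₀ ET : ℝ}
    (hM : ∀ (j : ℕ) (E : ℝ), E₀ ≤ E → E < ET → (j : ℝ) + 1 / 2 ≤ E →
      0 ≤ pointFunctional w z zb (crossF s (-1) (zMono E j)))
    (hB : ∑ k ∈ univ.erase a, |w k| * ((1 - z k) * (1 - zb k)) ^ s * qd k ^ ET
          + ∑ k, |w k| * (z k * zb k) ^ s * qr k ^ ET ≤ w a * ((1 - z a) * (1 - zb a)) ^ s)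
    {Δ : ℝ} {ℓ : ℕ} (hΔ : unitarityBound3D ℓ < Δ) (hreg : ¬ accidentalDegeneracy3D Δ ℓ)
    (hΔ0 : E₀ ≤ Δ) :
    BlockPositive (pointFunctional w z zb) s Δ ℓ := by
  refine blockPositive_pointFunctional_of_forall w z zb hz hzb hΔ hreg fun q hq => ?_
  have hjE : (q.2 : ℝ) + 1 / 2 ≤ Δ + (q.1 : ℝ) := by
    have h1 : (q.2 : ℝ) ≤ (ℓ : ℝ) + (q.1 : ℝ) := by exact_mod_cast hq.2.1
    linarith [natCast_add_half_le_unitarityBound3D ℓ]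
  have hE0 : E₀ ≤ Δ + (q.1 : ℝ) := hΔ0.trans (le_add_of_nonneg_right (Nat.cast_nonneg _))
  by_cases hlt : Δ + (q.1 : ℝ) < ET
  · exact hM q.2 (Δ + (q.1 : ℝ)) hE0 hlt hjE
  · exact term_nonneg_of_apex w z zb hz hzb hord a qd qr hqd hqr hdomd hdomr hB (by linarith)
      (not_lt.1 hlt)

/-- **Obligation (O5) with a split tail, on a box.** For a point functional in the dominated
configuration with `0 ≤ w_a`, external dimensions `s ∈ [s_lo, s_hi]` on `Q`:
rule (M) — termwise positivity of `Φ(E, j, s)` for `E ∈ [E₀, E_T)`, `j + 1/2 ≤ E`, all `(s, ·) ∈ Q`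
(to be discharged box by box with `termwise_nonneg_of_cornerBound`) — and rule (T) — the apex
inequality with exponents `E_T`, `s_lo`, `s_hi` — give the (O5) field of `SingleCorrelatorObligations`
with `Δ⋆ = E₀`: `BlockPositive φ s Δ ℓ` for every spin `ℓ`, every `Δ ≥ E₀` with
`unitarityBound3D ℓ ≤ Δ` (non-regular points by the limit clause). [folklore] -/
theorem tail_nonneg_pointFunctional_of_termwise_and_apex {N : ℕ} (w z zb : Fin N → ℝ)
    (hz : ∀ k, z k ∈ Ioo (0 : ℝ) 1) (hzb : ∀ k, zb k ∈ Ioo (0 : ℝ) 1) (hord : ∀ k, zb k ≤ z k)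
    (a : Fin N) (ha : 0 ≤ w a) (qd qr : Fin N → ℝ) (hqd : ∀ k, 0 < qd k ∧ qd k ≤ 1)
    (hqr : ∀ k, 0 < qr k ∧ qr k ≤ 1)
    (hdomd : ∀ k, z k * zb k ≤ qd k ^ 2 * (z a * zb a) ∧ z k ≤ qd k * z a)
    (hdomr : ∀ k, (1 - z k) * (1 - zb k) ≤ qr k ^ 2 * (z a * zb a) ∧ 1 - zb k ≤ qr k * z a)
    {Q : Set (ℝ × ℝ)} {slo shi E₀ ET : ℝ} (hQ : ∀ p ∈ Q, slo ≤ p.1 ∧ p.1 ≤ shi)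
    (hM : ∀ (j : ℕ) (E : ℝ), E₀ ≤ E → E < ET → (j : ℝ) + 1 / 2 ≤ E → ∀ p ∈ Q,
      0 ≤ pointFunctional w z zb (crossF p.1 (-1) (zMono E j)))
    (hB : ∑ k ∈ univ.erase a, |w k| * ((1 - z k) * (1 - zb k)) ^ slo * qd k ^ ET
          + ∑ k, |w k| * (z k * zb k) ^ slo * qr k ^ ET ≤ w a * ((1 - z a) * (1 - zb a)) ^ shi) :
    ∀ p ∈ Q, ∀ ℓ : ℕ, ∀ Δ : ℝ, unitarityBound3D ℓ ≤ Δ → E₀ ≤ Δ →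
      BlockPositive (pointFunctional w z zb) p.1 Δ ℓ := by
  intro p hp ℓ Δ hbd hΔ0
  have hBs := apexIneq_of_box w z zb hz hzb a ha qd qr (fun k => (hqd k).1.le)
    (fun k => (hqr k).1.le) (hQ p hp) hB
  have hMs : ∀ (j : ℕ) (E : ℝ), E₀ ≤ E → E < ET → (j : ℝ) + 1 / 2 ≤ E →
      0 ≤ pointFunctional w z zb (crossF p.1 (-1) (zMono E j)) :=
    fun j E h1 h2 h3 => hM j E h1 h2 h3 p hp
  by_cases hregpt : IsRegularPoint3D Δ ℓ
  · exact tail_blockPositive_of_termwise_and_apex w z zb hz hzb hord a qd qr hqd hqr hdomd hdomr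
      hMs hBs (lt_of_le_of_ne hbd (Ne.symm hregpt.1)) hregpt.2 hΔ0
  · refine blockPositive_of_eventually_right w z zb hz hzb p.1 Δ ℓ hregpt ?_
    filter_upwards [eventually_isRegularPoint3D_nhdsGT_of_bound_le hbd, self_mem_nhdsWithin]
      with Δ' hΔ' hgt
    have hgt' : Δ < Δ' := Set.mem_Ioi.1 hgt
    exact ⟨hΔ', tail_blockPositive_of_termwise_and_apex w z zb hz hzb hord a qd qr hqd hqr hdomd
      hdomr hMs hBs (lt_of_le_of_lt hbd hgt') hΔ'.2 (hΔ0.trans hgt'.le)⟩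

end Literature.MathematicalPhysics.QuantumFieldTheory.ConformalBootstrap3D
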